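import Literature.MathematicalPhysics.QuantumFieldTheory.Balaban1983to89.T4OutputRate

/-!
# T⁴ programme, spine estimate NE9 (node U3, history side) — AT A FIXED NUMBER OF SCALES THE FADING-MEMORY CLAUSE IS FREE:
# the content of `NE9 ∧ FadingMemory` is the K-UNIFORMITY of its constants (census item of cell `pub-balaban-gaps`, seat ne9)

Cell `pub-balaban-gaps` (YM blitz G2, seat ne9, unit `pub-balaban-gaps-ne9-g0`; record `run/shared/lean/pub/pub-balaban-gaps/ne/NE9.md`
§5 row C11).  Summits-side bookkeeping over the Literature SHAPES `T4OutputRate.NE9` ∕ `T4OutputRate.FadingMemory` only; nothing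
of the row's 265 `Support/NE9*` modules is imported or edited.

WHY.  The REPAIR CENSUS of estimate NE9 asks whether a FINITE-CERTIFIED SUBSTITUTE could stand in for NE9 (joint Lipschitz
dependence of Bałaban's scale-`j` term `E^{(j)}(X; g⃗, U)` on the coupling history, with fading-memory moduli
`Λ j i ≤ C₉·ω^{j−i}`).  This file settles that census item in the kernel, NEGATIVELY: on carriers with finitely many creation steps
(`scale X ≤ K` for every localization domain `X` — the situation at ANY FIXED lattice spacing `ε = L^{−K}`, [Balaban1987RG1] (0.1)
p. 251) EVERY family of NE9 moduli bounded by `M` can be replaced by one that has fading memory at ANY rate `ω ∈ ]0, 1]` with the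
constant `C₉ = M·(ω⁻¹)^K` (`ne9_and_fadingMemory_of_boundedScales`).  So at fixed `K` the clause `FadingMemory` costs nothing, and
`NE9 ∧ FadingMemory` carries information ONLY through the independence of `(C₉, ω, κ)` from `K` — i.e. from the lattice spacing.
No computation at a fixed lattice (however certified) can substitute for NE9; the estimate is a UNIFORMITY statement, exactly as
print phrases UV stability ([Balaban1987RG1] p. 259: *"the above bound is uniform in the lattice spacing ε. This is the essence of
the ultraviolet stability concept"*).  The complementary kernel facts are already in the tree: with UNBOUNDED scales a sticky
recursion admits NO fading family (`T4HistoryLipschitzRecursion.sticky_not_fadingMemory`), and without fading the node-U3 coupling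
bracket has no rate (`T4OutputRateWitness.couplingBracket_not_atRate`, `T4OutputRate.historySum_const`).

WHAT IS PROVED (kernel; elementary real arithmetic, `[folklore]`):
* `ne9_congr_moduli` — `NE9` reads the moduli only at pairs `(scale X, i)` with `i < scale X`: two families agreeing there give
  the same proposition.
* `fadingMemory_truncate` — a family supported on `{i < k ≤ K}` and bounded there by `M ≥ 0` has `FadingMemory (M·(ω⁻¹)^K) ω` for
  every `0 < ω ≤ 1`.
* `ne9_and_fadingMemory_of_boundedScales` — HEADLINE: bounded scales + NE9 with moduli `0 ≤ Λ k i ≤ M` (`i < k ≤ K`) ⇒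
  `NE9 ∧ FadingMemory (M·(ω⁻¹)^K) ω` for the truncated family, any `ω ∈ ]0, 1]`.
* `ne9_and_fadingMemory_of_boundedScales_const` — the same from CONSTANT moduli `Λ ≡ M` (uniform coordinatewise Lipschitz, the
  shape `T4CouplingAnalyticity.ne9_of_coordLipschitz` produces from the printed-TYPE smoothness in each coupling).

HONEST FRAMING: bookkeeping for rung (B)+1 on a FIXED finite four-torus; a census NO-GO about the SHAPE of NE9, not a statement about
Bałaban's functionals; NE9 is NOT PRINTED ([Balaban1987RG1] p. 263 gives only *"It is a C^∞-function of g_{j−1} ∈ [0, γ], (or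
analytic)"* and p. 256 ∕ p. 298 the existence of the dependence on all preceding couplings) and NOT PROVED; spine PROVED 0∕9
unchanged; NOT UV stability, NOT the continuum limit, NOT infinite volume, NOT a mass gap, NOT Clay.  HONEST DEPENDENCY: continuum
YM on T⁴ ⇐ BetaPertH ∧ nine spine estimates (0∕9 proved); BetaPertH ⇐ (D1) ∧ (D4) ∧ CAP+tail.

References (TYPES only): [Balaban1987RG1] = T. Bałaban, Commun. Math. Phys. **109** (1987) 249–301, (0.1) p. 251, p. 256, Thm 1
p. 259, p. 263, p. 298.
-/

namespace Summit.QuantumFields.BalabanUV.T4Continuum.NE9.FiniteScaleVacuity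

open scoped BigOperators
open Literature.MathematicalPhysics.QuantumFieldTheory.Balaban1983to89
open Literature.MathematicalPhysics.QuantumFieldTheory.Balaban1983to89.T4OutputRate

variable {C : Carriers} {Bg : Type}

/-- `NE9` evaluates the moduli only at `(scale X, i)` with `i < scale X`: families that agree on those pairs define the same
hypothesis.  (Node U3 never reads `Λ k k` or `Λ k i` at a step `k` that is not a creation step.) [folklore] -/
theorem ne9_congr_moduli {E : Functional C Bg} {W : Set (ℕ → ℝ)} {κ : ℝ} {Λ Λ' : ℕ → ℕ → ℝ}
    (hagree : ∀ (X : C.Dom) (i : ℕ), i < C.scale X → Λ (C.scale X) i = Λ' (C.scale X) i) :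
    NE9 E W κ Λ ↔ NE9 E W κ Λ' := by
  have key : ∀ (X : C.Dom) (g g' : ℕ → ℝ),
      ∑ i ∈ Finset.range (C.scale X), Λ (C.scale X) i * |g i - g' i|
        = ∑ i ∈ Finset.range (C.scale X), Λ' (C.scale X) i * |g i - g' i| := by
    intro X g g'
    refine Finset.sum_congr rfl fun i hi => ?_
    rw [Finset.mem_range] at hi
    rw [hagree X i hi]
  constructor
  · intro h g hg g' hg' U X
    rw [← key X g g']
    exact h g hg g' hg' U X
  · intro h g hg g' hg' U X
    rw [key X g g']
    exact h g hg g' hg' U X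

/-- TRUNCATION HAS FADING MEMORY AT ANY RATE.  A moduli family vanishing unless `i < k ≤ K` and bounded by `M ≥ 0` there satisfies
`FadingMemory (M·(ω⁻¹)^K) ω` for every `0 < ω ≤ 1`: for `i < k ≤ K`, `ω^{k−i} ≥ ω^K`, so `M ≤ M·ω^{−K}·ω^{k−i}`.  The constant
`M·(ω⁻¹)^K` is the whole point: it is finite for each `K` and blows up as `K → ∞` (for `ω < 1`). [folklore] -/
theorem fadingMemory_truncate {Λ : ℕ → ℕ → ℝ} {M ω : ℝ} {K : ℕ} (hM : 0 ≤ M) (hω : 0 < ω) (hω1 : ω ≤ 1)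
    (h0 : ∀ k i, i ≤ k → 0 ≤ Λ k i) (hb : ∀ k i, i < k → k ≤ K → Λ k i ≤ M) :
    FadingMemory (M * ω⁻¹ ^ K) ω (fun k i => if i < k ∧ k ≤ K then Λ k i else 0) := by
  intro k i hik
  dsimp only
  have hωK : 0 < ω ^ K := pow_pos hω K
  have hinv : ω⁻¹ ^ K = (ω ^ K)⁻¹ := by rw [inv_pow]
  have hC : 0 ≤ M * ω⁻¹ ^ K := mul_nonneg hM (by rw [hinv]; exact inv_nonneg.mpr hωK.le)
  have hrhs : 0 ≤ M * ω⁻¹ ^ K * ω ^ (k - i) := mul_nonneg hC (pow_nonneg hω.le _)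
  by_cases hc : i < k ∧ k ≤ K
  · rw [if_pos hc]
    refine ⟨h0 k i hik, ?_⟩
    -- ω^(k-i) ≥ ω^K since k - i ≤ K and ω ≤ 1
    have hpow : ω ^ K ≤ ω ^ (k - i) := pow_le_pow_of_le_one hω.le hω1 (by omega)
    calc Λ k i ≤ M := hb k i hc.1 hc.2
      _ = M * ω⁻¹ ^ K * ω ^ K := by rw [hinv, mul_assoc, inv_mul_cancel₀ hωK.ne', mul_one]
      _ ≤ M * ω⁻¹ ^ K * ω ^ (k - i) := mul_le_mul_of_nonneg_left hpow hC
  · rw [if_neg hc]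
    exact ⟨le_rfl, hrhs⟩

/-- **HEADLINE — AT FINITELY MANY SCALES, FADING MEMORY IS FREE.**  If every localization domain is created at a step `≤ K`
(finitely many scales: the situation at any FIXED lattice spacing `L^{−K}`), and `E` satisfies `NE9` with SOME moduli family that is
nonnegative and bounded by `M` on the pairs `i < k ≤ K`, then for EVERY rate `ω ∈ ]0, 1]` the truncated family is again a family of
NE9 moduli for `E` AND has `FadingMemory` with constant `C₉ = M·(ω⁻¹)^K`.  Consequently the conjunction `NE9 ∧ FadingMemory` that node
U3 ∕ U5b consume has content only through the `K`-INDEPENDENCE of `(C₉, ω)` (and of `κ`, `W`): no finite-`K` certificate substitutes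
for the estimate (REPAIR CENSUS of NE9, row C11: finite-certified substitute — VACUOUS).  Compare the unbounded-scale no-go
`T4HistoryLipschitzRecursion.sticky_not_fadingMemory`. [folklore] -/
theorem ne9_and_fadingMemory_of_boundedScales {E : Functional C Bg} {W : Set (ℕ → ℝ)} {κ M ω : ℝ} {K : ℕ}
    {Λ : ℕ → ℕ → ℝ} (hK : ∀ X : C.Dom, C.scale X ≤ K) (h9 : NE9 E W κ Λ)
    (h0 : ∀ k i, i ≤ k → 0 ≤ Λ k i) (hb : ∀ k i, i < k → k ≤ K → Λ k i ≤ M) (hM : 0 ≤ M)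
    (hω : 0 < ω) (hω1 : ω ≤ 1) :
    NE9 E W κ (fun k i => if i < k ∧ k ≤ K then Λ k i else 0) ∧
      FadingMemory (M * ω⁻¹ ^ K) ω (fun k i => if i < k ∧ k ≤ K then Λ k i else 0) := by
  refine ⟨?_, fadingMemory_truncate hM hω hω1 h0 hb⟩
  refine (ne9_congr_moduli (Λ := Λ) (Λ' := fun k i => if i < k ∧ k ≤ K then Λ k i else 0) ?_).mp h9
  intro X i hi
  simp only [hi, hK X, and_self, if_true]

/-- COROLLARY — FROM CONSTANT MODULI (uniform coordinatewise Lipschitz, the output SHAPE of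
`T4CouplingAnalyticity.ne9_of_coordLipschitz` ∕ `T4OutputRate.historySum_const`): with finitely many scales, `NE9 E W κ (fun _ _ => M)`
alone yields `NE9 ∧ FadingMemory (M·(ω⁻¹)^K) ω` at every rate `ω ∈ ]0, 1]`.  At UNBOUNDED scales the constant family has NO fading
(`historySum_const`: the history bracket grows with the creation step) — the dichotomy that makes NE9's `FadingMemory` a statement
about `K → ∞` only. [folklore] -/
theorem ne9_and_fadingMemory_of_boundedScales_const {E : Functional C Bg} {W : Set (ℕ → ℝ)} {κ M ω : ℝ} {K : ℕ}
    (hK : ∀ X : C.Dom, C.scale X ≤ K) (h9 : NE9 E W κ (fun _ _ => M)) (hM : 0 ≤ M)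
    (hω : 0 < ω) (hω1 : ω ≤ 1) :
    NE9 E W κ (fun k i => if i < k ∧ k ≤ K then M else 0) ∧
      FadingMemory (M * ω⁻¹ ^ K) ω (fun k i => if i < k ∧ k ≤ K then M else 0) :=
  ne9_and_fadingMemory_of_boundedScales (Λ := fun _ _ => M) hK h9 (fun _ _ _ => hM) (fun _ _ _ _ => le_rfl)
    hM hω hω1

/-- THE CONSTANT IS SHARP IN `K` for the constant family: if the truncated constant family has `FadingMemory C₉ ω` then, read
at the pair `(K, 0)` (when `1 ≤ K`), `M ≤ C₉·ω^K`, i.e. `C₉ ≥ M·ω^{−K}` for `ω > 0`.  So the free constant of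
`ne9_and_fadingMemory_of_boundedScales_const` cannot be improved, and for `0 < ω < 1`, `0 < M` it diverges geometrically in the
number of scales — the quantitative form of «NE9's content is K-uniformity». [folklore] -/
theorem fadingMemory_truncate_const_sharp {M ω C₉ : ℝ} {K : ℕ} (hK : 1 ≤ K)
    (hF : FadingMemory C₉ ω (fun k i => if i < k ∧ k ≤ K then M else 0)) : M ≤ C₉ * ω ^ K := by
  have h := (hF K 0 (Nat.zero_le K)).2
  have hc : (0 : ℕ) < K ∧ K ≤ K := ⟨by omega, le_rfl⟩
  simp only [hc, and_self, if_true, Nat.sub_zero] at h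
  exact h

end Summit.QuantumFields.BalabanUV.T4Continuum.NE9.FiniteScaleVacuity
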